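import Literature.Probability.RandomPlanarGeometry.HexSAWLowerBound
import Mathlib.Analysis.SpecialFunctions.Exp
import HarnessLib

/-!
# Duminil-Copin–Smirnov: bridges, the Hammersley–Welsh decomposition and `μ ≤ √(2+√2)`

Topic `Literature/Probability/RandomPlanarGeometry`; fourth support file for the discharge of
`Literature.Probability.RandomPlanarGeometry.SAW.DuminilCopinSmirnov2012_thm1`. Source: H. Duminil-Copin, S. Smirnov, *The connective
constant of the honeycomb lattice equals `√(2+√2)`*, Ann. of Math. 175 (2012), 1653–1665
(arXiv:1007.0575), §3, proof of Theorem 1, second half: "It remains to prove the opposite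
inequality `μ ≤ x_c⁻¹`. To estimate the partition function from above, we will decompose
self-avoiding walks into bridges. A bridge of width `T` is a self-avoiding walk in `S_T` from one
side to the opposite side, defined up to vertical translation. The partition function of bridges
of width `T` is `B_T^x`, which is at most `1` by (4). Noting that a bridge of width `T` has
length at least `T`, we obtain for `x < x_c`: `B_T^x ≤ (x/x_c)^T B_T^{x_c} ≤ (x/x_c)^T`. Thus, for
`x < x_c`, the series `Σ_T B_T^x` converges and so does the product `∏_T (1 + B_T^x)`. … any
self-avoiding walk can be canonically decomposed into a sequence of bridges of widths
`T_{-i} < ⋯ < T_{-1}` and `T_0 > ⋯ > T_j`, and, if one fixes the starting mid-edge and the first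
vertex visited, the decomposition uniquely determines the walk [Hammersley–Welsh; Madras–Slade
§3.1] … `Z(x) ≤ 2 ∏_T (1 + B_T^x)² < ∞` … Therefore, `Z(x) < +∞` whenever `x < x_c` and
`μ ≤ x_c⁻¹ = √(2+√2)`", together with the printed proof of the decomposition ("Out of the vertices
having the maximal real part, choose the one visited last, say after `n` steps. The `n` first
vertices of the walk form a bridge … The consequent steps form a half-plane walk of width
`T₁ < T₀` … If `γ` is a self-avoiding walk in the plane, one can cut the trajectory into two
pieces").

## Contents

In `namespace Literature.SAW.HV` (combinatorics in the coordinate model, levels `lev`, any `x ≥ 0`):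
* `lastArgminBy`, `lastArgmin`, `lastArgmax` — last visit to the lowest/highest level;
  `toStd` — translation to the standard vertex `stdPt b = (0,0,b)` of the same type;
* `sawsUpTo v M` — self-avoiding walks from `v` with `≤ M` steps (vertex lists);
  `IsHalfSpace`, `SpanLE S`, `IsBridgeOf s` — half-space walks, span bounds, bridges of width
  `s` (Madras–Slade's definitions with DCS's level coordinate); `hsFin`, `brFin`, `wt`
  (generating functions `Σ x^{#steps}` of finite sets of walks);
* `hwFst`, `hwSnd`, `hw_injOn`, **`sum_hexSawCount_le`**: `Σ_{n ≤ N} cₙ xⁿ ≤ x⁻¹ H_{N+1}(x)²`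
  (every walk is a pair of half-space walks, cut at the last visit to the lowest level);
* `brPart`, `hsPart`, `brPart_injOn`, `hSum_succ_le`, **`hSum_le_prod`**:
  `H_{≤S} ≤ 2 ∏_{s ≤ S} (1 + B_s)` (a half-space walk is a bridge followed by a flipped
  half-space walk of smaller span);
* `brFin_subset_bridgeLists`, `wt_brFin_odd_le`, `wt_brFin_even_le`, `wt_brFin_true_le`,
  `stripB_le_pow_mul` — bridges from the two standard vertices versus DCS's `B_{T,L}^x`, and
  `B_{T,L}^x ≤ (x/y)^{2T} B_{T,L}^y`.
In `namespace Literature.SAW` (consequences of `DuminilCopinSmirnov2012_lemma2`):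
* `stripB_le_pow` (`B_{T,L}^x ≤ (x/x_c)^{2T}`), `bSum_le`, `prod_bSum_le`,
  **`summable_of_lemma2`** (`Σ cₙ xⁿ < ∞` for `0 < x < x_c`),
  `hexConnectiveConstant_mul_lt_one`, **`hexConnectiveConstant_le_sqrt_of_lemma2`**
  (`μ ≤ √(2+√2)`), and **`DuminilCopinSmirnov2012_thm1_of_lemma2`**: Lemma 2 implies Theorem 1.

## Design

Widths are measured in levels (our strips are two levels per row of hexagons, so DCS's bridges
of width `T` have level-width `2T - 1` and at least `2T` vertices); bridges of even level-width
and bridges starting at a type-`1` vertex are compared with `B_{T,L}` by adding one step. All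
generating functions are truncated at `≤ M` steps (finite sums); the bounds are uniform in `M`,
which gives summability.
-/

noncomputable section

open Finset Filter Topology Literature.Probability.LatticeModels Literature.Probability.Percolation

namespace Literature.Probability.RandomPlanarGeometry.SAW

namespace HV

/-! ### Levels under the automorphisms, and along chains -/

/-- The central flip reverses levels: `lev (flip v) = -lev v - 1`. [folklore] -/
@[simp] theorem lev_flip (v : HV) : lev (flip v) = -lev v - 1 := by
  obtain ⟨a, b, c⟩ := v; cases c <;> simp [lev, bit] <;> ring

/-- Translations shift levels by twice the vertical component. [folklore] -/
@[simp] theorem lev_shift (a b : ℤ) (v : HV) : lev (shift a b v) = lev v + 2 * b := by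
  obtain ⟨p, q, c⟩ := v; cases c <;> simp [lev, bit] <;> ring

/-- Along a chain of adjacent vertices the level moves by at most one per step (upwards).
[cite: DuminilCopinSmirnov2012, §3 ("a bridge of width T has length at least T")] -/
theorem lev_getElem_sub_le {l : List HV} (hc : l.IsChain hvGraph.Adj) {i j : ℕ} (hij : i ≤ j)
    (hj : j < l.length) : lev (l[j]) - lev (l[i]'(lt_of_le_of_lt hij hj)) ≤ (j : ℤ) - i := by
  induction j with
  | zero =>
    obtain rfl : i = 0 := by omega
    simp
  | succ j ih =>
    rcases Nat.eq_or_lt_of_le hij with rfl | hlt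
    · simp
    · have h1 := ih (by omega) (by omega)
      have h2 := lev_eq_of_adj (hc.getElem j (by omega))
      push_cast
      omega

/-- Along a chain of adjacent vertices the level moves by at most one per step (downwards).
[folklore] -/
theorem lev_getElem_sub_ge {l : List HV} (hc : l.IsChain hvGraph.Adj) {i j : ℕ} (hij : i ≤ j)
    (hj : j < l.length) : (i : ℤ) - j ≤ lev (l[j]) - lev (l[i]'(lt_of_le_of_lt hij hj)) := by
  induction j with
  | zero =>
    obtain rfl : i = 0 := by omega
    simp
  | succ j ih =>
    rcases Nat.eq_or_lt_of_le hij with rfl | hlt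
    · simp
    · have h1 := ih (by omega) (by omega)
      have h2 := lev_eq_of_adj (hc.getElem j (by omega))
      push_cast
      omega

/-- The first coordinate moves by at most one per step. [folklore] -/
theorem abs_fst_sub_le {l : List HV} (hc : l.IsChain hvGraph.Adj) {i j : ℕ} (hij : i ≤ j)
    (hj : j < l.length) : |(l[j]).1 - (l[i]'(lt_of_le_of_lt hij hj)).1| ≤ (j : ℤ) - i := by
  induction j with
  | zero =>
    obtain rfl : i = 0 := by omega
    simp
  | succ j ih =>
    rcases Nat.eq_or_lt_of_le hij with rfl | hlt
    · simp
    · have h1 := ih (by omega) (by omega)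
      have h2 := (abs_sub_le_one_of_adj (hc.getElem j (by omega))).1
      rw [abs_le] at h1 h2 ⊢
      push_cast
      omega

/-! ### Last extremal index along a list -/

/-- `getD` agrees with `getElem` in range. [folklore] -/
theorem getD_eq_getElem' {l : List HV} {d : HV} {n : ℕ} (hn : n < l.length) : l.getD n d = l[n] := by
  rw [List.getD_eq_getElem?_getD, List.getElem?_eq_getElem hn, Option.getD_some]

section Argmin

variable (f : HV → ℤ)

/-- The indices of `l` at which `f` is minimal. [folklore] -/
def argminSet (l : List HV) : Finset ℕ :=
  (range l.length).filter fun i => ∀ j < l.length, f (l.getD i hvOrigin) ≤ f (l.getD j hvOrigin)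

/-- A nonempty list has a minimising index. [folklore] -/
theorem argminSet_nonempty {l : List HV} (hl : l ≠ []) : (argminSet f l).Nonempty := by
  have hne : (range l.length).Nonempty := ⟨0, mem_range.2 (List.length_pos_iff.2 hl)⟩
  obtain ⟨i, hi, hmin⟩ := exists_min_image (range l.length) (fun i => f (l.getD i hvOrigin)) hne
  exact ⟨i, mem_filter.2 ⟨hi, fun j hj => hmin j (mem_range.2 hj)⟩⟩

/-- **The last index minimising `f` along `l`** (junk `0` for the empty list): DCS/Hammersley–Welsh
cut walks at the last visit to an extremal level. [cite: DuminilCopinSmirnov2012, §3 ("Out of the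
vertices having the maximal real part, choose the one visited last")] -/
def lastArgminBy (l : List HV) : ℕ :=
  if h : (argminSet f l).Nonempty then (argminSet f l).max' h else 0

/-- Specification of `lastArgminBy`: it is an index of minimal `f`-value, and every later index
has strictly larger `f`-value. [folklore] -/
theorem lastArgminBy_spec {l : List HV} (hl : l ≠ []) :
    lastArgminBy f l < l.length ∧
      (∀ j < l.length, f (l.getD (lastArgminBy f l) hvOrigin) ≤ f (l.getD j hvOrigin)) ∧
      ∀ j < l.length, lastArgminBy f l < j →
        f (l.getD (lastArgminBy f l) hvOrigin) < f (l.getD j hvOrigin) := by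
  have hne := argminSet_nonempty f hl
  rw [lastArgminBy, dif_pos hne]
  have hmem := (argminSet f l).max'_mem hne
  change _ ∈ (range l.length).filter _ at hmem
  rw [mem_filter, mem_range] at hmem
  refine ⟨hmem.1, hmem.2, fun j hj hlt => lt_of_le_of_ne (hmem.2 j hj) fun heq => ?_⟩
  have : j ∈ argminSet f l := by
    change _ ∈ (range l.length).filter _
    exact mem_filter.2 ⟨mem_range.2 hj, fun k hk => heq.ge.trans (hmem.2 k hk)⟩
  exact absurd ((argminSet f l).le_max' j this) (not_le.2 hlt)

end Argmin

/-- The last visit to the lowest level. [cite: DuminilCopinSmirnov2012, §3 (bridge decomposition)] -/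
def lastArgmin (l : List HV) : ℕ := lastArgminBy lev l

/-- The last visit to the highest level. [cite: DuminilCopinSmirnov2012, §3 (bridge decomposition)] -/
def lastArgmax (l : List HV) : ℕ := lastArgminBy (fun v => -lev v) l

/-- Specification of `lastArgmin` with `getElem`. [folklore] -/
theorem lastArgmin_spec {l : List HV} (hl : l ≠ []) :
    ∃ hm : lastArgmin l < l.length,
      (∀ (j : ℕ) (hj : j < l.length), lev l[lastArgmin l] ≤ lev l[j]) ∧
      ∀ (j : ℕ) (hj : j < l.length), lastArgmin l < j → lev l[lastArgmin l] < lev l[j] := by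
  obtain ⟨hm, h1, h2⟩ := lastArgminBy_spec lev hl
  refine ⟨hm, fun j hj => ?_, fun j hj hlt => ?_⟩
  · have := h1 j hj
    rw [getD_eq_getElem' hm, getD_eq_getElem' hj] at this
    exact this
  · have := h2 j hj hlt
    rw [getD_eq_getElem' hm, getD_eq_getElem' hj] at this
    exact this

/-- Specification of `lastArgmax` with `getElem`. [folklore] -/
theorem lastArgmax_spec {l : List HV} (hl : l ≠ []) :
    ∃ hm : lastArgmax l < l.length,
      (∀ (j : ℕ) (hj : j < l.length), lev l[j] ≤ lev l[lastArgmax l]) ∧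
      ∀ (j : ℕ) (hj : j < l.length), lastArgmax l < j → lev l[j] < lev l[lastArgmax l] := by
  obtain ⟨hm, h1, h2⟩ := lastArgminBy_spec (fun v => -lev v) hl
  refine ⟨hm, fun j hj => ?_, fun j hj hlt => ?_⟩
  · have := h1 j hj
    rw [getD_eq_getElem' hm, getD_eq_getElem' hj] at this
    change -lev l[lastArgmax l] ≤ -lev l[j] at this
    omega
  · have := h2 j hj hlt
    rw [getD_eq_getElem' hm, getD_eq_getElem' hj] at this
    change -lev l[lastArgmax l] < -lev l[j] at this
    omega

/-! ### Translating a walk to a standard starting point -/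

/-- The standard vertex of each type: `(0, 0, b)` (`O` for `b = false`). [folklore] -/
def stdPt (b : Bool) : HV := (0, 0, b)

/-- `stdPt false = O`. [folklore] -/
@[simp] theorem stdPt_false : stdPt false = hvOrigin := rfl

/-- The standard vertex of type `1` is on level `1`. [folklore] -/
@[simp] theorem lev_stdPt_true : lev (stdPt true) = 1 := rfl

/-- Translate a vertex list so that its head becomes the standard vertex of its type.
[cite: DuminilCopinSmirnov2012, §3 ("defined up to vertical translation")] -/
def toStd (l : List HV) : List HV :=
  l.map (shift (-(l.headD hvOrigin).1) (-(l.headD hvOrigin).2.1))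

/-- `toStd` preserves lengths. [folklore] -/
@[simp] theorem length_toStd (l : List HV) : (toStd l).length = l.length := List.length_map _

/-- Entries of `toStd l`. [folklore] -/
theorem getElem_toStd (l : List HV) {i : ℕ} (hi : i < (toStd l).length) :
    (toStd l)[i] = shift (-(l.headD hvOrigin).1) (-(l.headD hvOrigin).2.1) (l[i]'(by simpa using hi)) :=
  List.getElem_map _

/-- Levels along `toStd l` are those of `l`, shifted uniformly. [folklore] -/
theorem lev_getElem_toStd (l : List HV) {i : ℕ} (hi : i < (toStd l).length) :
    lev (toStd l)[i] = lev (l[i]'(by simpa using hi)) - 2 * (l.headD hvOrigin).2.1 := by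
  rw [getElem_toStd, lev_shift]; ring

/-- The head of `toStd l` is the standard vertex of the type of the head of `l`. [folklore] -/
theorem head?_toStd {l : List HV} {v : HV} (h : l.head? = some v) :
    (toStd l).head? = some (stdPt v.2.2) := by
  rw [toStd, List.head?_map, h, Option.map_some, List.headD_eq_head?_getD, h, Option.getD_some]
  simp [stdPt]

/-- `toStd` preserves chains. [folklore] -/
theorem isChain_toStd {l : List HV} (h : l.IsChain hvGraph.Adj) : (toStd l).IsChain hvGraph.Adj := by
  rw [toStd, List.isChain_map]
  exact h.imp fun x y hxy => (shift _ _).map_rel_iff.2 hxy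

/-- `toStd` preserves distinctness. [folklore] -/
theorem nodup_toStd {l : List HV} (h : l.Nodup) : (toStd l).Nodup := h.map (shift _ _).injective

/-- `toStd` is injective among lists with a common head. [folklore] -/
theorem toStd_inj_of_head {l l' : List HV} (h : toStd l = toStd l') (hh : l.head? = l'.head?) :
    l = l' := by
  have : l.headD hvOrigin = l'.headD hvOrigin := by
    rw [List.headD_eq_head?_getD, List.headD_eq_head?_getD, hh]
  rw [toStd, toStd, this] at h
  exact (List.map_injective_iff.2 (RelIso.injective _)) h

/-- `toStd` is injective among lists with a common last element. [folklore] -/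
theorem toStd_inj_of_getLast {l l' : List HV} (h : toStd l = toStd l') (hl : l ≠ []) (hl' : l' ≠ [])
    (hh : l.getLast hl = l'.getLast hl') : l = l' := by
  have e := congrArg List.getLast? h
  rw [toStd, toStd, List.getLast?_map, List.getLast?_map, List.getLast?_eq_some_getLast hl,
    List.getLast?_eq_some_getLast hl', Option.map_some, Option.map_some, Option.some_inj, hh,
    shift_apply, shift_apply, Prod.mk.injEq, Prod.mk.injEq] at e
  have e1 : (l.headD hvOrigin).1 = (l'.headD hvOrigin).1 := by linarith [e.1]
  have e2 : (l.headD hvOrigin).2.1 = (l'.headD hvOrigin).2.1 := by linarith [e.2.1]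
  rw [toStd, toStd, e1, e2] at h
  exact (List.map_injective_iff.2 (RelIso.injective _)) h

/-! ### Self-avoiding walks of bounded length; half-space walks and bridges -/

/-- The self-avoiding walks from `v` with at most `M` steps, as vertex lists. [folklore] -/
def sawsUpTo (v : HV) (M : ℕ) : Finset (List HV) := (range (M + 1)).biUnion fun n => sawFin v n

/-- Membership in `sawsUpTo`. [folklore] -/
theorem mem_sawsUpTo_iff {v : HV} {M : ℕ} {l : List HV} :
    l ∈ sawsUpTo v M ↔ l.IsChain hvGraph.Adj ∧ l.head? = some v ∧ l.Nodup ∧ l.length ≤ M + 1 := by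
  simp only [sawsUpTo, mem_biUnion, mem_range, mem_sawFin_iff, mem_sawLists_iff]
  constructor
  · rintro ⟨n, hn, hc, hh, hl, hnd⟩
    exact ⟨hc, hh, hnd, by omega⟩
  · rintro ⟨hc, hh, hnd, hl⟩
    have : l ≠ [] := by rintro rfl; simp at hh
    have hpos := List.length_pos_iff.2 this
    exact ⟨l.length - 1, by omega, hc, hh, by omega, hnd⟩

/-- Members of `sawsUpTo` are nonempty. [folklore] -/
theorem ne_nil_of_mem_sawsUpTo {v : HV} {M : ℕ} {l : List HV} (h : l ∈ sawsUpTo v M) : l ≠ [] := by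
  rintro rfl; simp [mem_sawsUpTo_iff] at h

/-- The first entry of a member of `sawsUpTo v M` is `v`. [folklore] -/
theorem getElem_zero_of_mem_sawsUpTo {v : HV} {M : ℕ} {l : List HV} (h : l ∈ sawsUpTo v M)
    (h0 : 0 < l.length) : l[0] = v := by
  have := (mem_sawsUpTo_iff.1 h).2.1
  rw [List.head?_eq_getElem?, List.getElem?_eq_getElem h0, Option.some_inj] at this
  exact this

/-- `sawsUpTo` is monotone in the length bound. [folklore] -/
theorem sawsUpTo_mono {v : HV} {M M' : ℕ} (h : M ≤ M') : sawsUpTo v M ⊆ sawsUpTo v M' := by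
  intro l hl
  rw [mem_sawsUpTo_iff] at hl ⊢
  exact ⟨hl.1, hl.2.1, hl.2.2.1, by omega⟩

/-- Walks from different vertices are different. [folklore] -/
theorem disjoint_sawsUpTo {v w : HV} (h : v ≠ w) (M M' : ℕ) :
    Disjoint (sawsUpTo v M) (sawsUpTo w M') := by
  rw [Finset.disjoint_left]
  intro l hl hl'
  rw [mem_sawsUpTo_iff] at hl hl'
  exact h (Option.some_inj.1 (hl.2.1.symm.trans hl'.2.1))

/-- `toStd` maps `sawsUpTo v M` into `sawsUpTo (stdPt v.type) M`. [folklore] -/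
theorem toStd_mem_sawsUpTo {v : HV} {M : ℕ} {l : List HV} (h : l ∈ sawsUpTo v M) :
    toStd l ∈ sawsUpTo (stdPt v.2.2) M := by
  rw [mem_sawsUpTo_iff] at h ⊢
  exact ⟨isChain_toStd h.1, head?_toStd h.2.1, nodup_toStd h.2.2.1, by simpa using h.2.2.2⟩

/-- **Half-space walk**: every vertex after the first lies strictly above the level of the first
("the start of `γ̃` has extremal [minimal] real part").
[cite: DuminilCopinSmirnov2012, §3 (proof of the bridge decomposition)] -/
def IsHalfSpace (l : List HV) : Prop :=
  ∀ (i : ℕ) (h : i < l.length), 0 < i → lev (l[0]'(Nat.zero_lt_of_lt h)) < lev l[i]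

/-- The walk climbs at most `S` levels above its start. [cite: DuminilCopinSmirnov2012, §3 ("width")] -/
def SpanLE (S : ℤ) (l : List HV) : Prop :=
  ∀ (i : ℕ) (h : i < l.length), lev l[i] ≤ lev (l[0]'(Nat.zero_lt_of_lt h)) + S

/-- **Bridge of width `s`** (Hammersley–Welsh, level version): a half-space walk whose last vertex
is on the highest level, `s` above the first ("a self-avoiding walk in `S_T` from one side to
the opposite side"). [cite: DuminilCopinSmirnov2012, §3 ("A bridge of width T")] -/
def IsBridgeOf (s : ℤ) (l : List HV) : Prop :=
  IsHalfSpace l ∧ SpanLE s l ∧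
    ∀ h : 0 < l.length, lev (l[l.length - 1]'(by omega)) = lev (l[0]'h) + s

/-- The half-space walks from `v` of at most `M` steps and span at most `S`.
[cite: DuminilCopinSmirnov2012, §3] -/
def hsFin (v : HV) (M : ℕ) (S : ℤ) : Finset (List HV) :=
  open scoped Classical in (sawsUpTo v M).filter fun l => IsHalfSpace l ∧ SpanLE S l

/-- The bridges from `v` of at most `M` steps and width exactly `s`.
[cite: DuminilCopinSmirnov2012, §3] -/
def brFin (v : HV) (M : ℕ) (s : ℤ) : Finset (List HV) :=
  open scoped Classical in (sawsUpTo v M).filter fun l => IsBridgeOf s l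

/-- The generating function `Σ_{ω ∈ F} x^{#steps(ω)}` of a finite set of walks. [folklore] -/
def wt (x : ℝ) (F : Finset (List HV)) : ℝ := ∑ l ∈ F, x ^ (l.length - 1)

/-- Membership in `hsFin`. [folklore] -/
theorem mem_hsFin_iff {v : HV} {M : ℕ} {S : ℤ} {l : List HV} :
    l ∈ hsFin v M S ↔ l ∈ sawsUpTo v M ∧ IsHalfSpace l ∧ SpanLE S l := by
  classical
  rw [hsFin, mem_filter]

/-- Membership in `brFin`. [folklore] -/
theorem mem_brFin_iff {v : HV} {M : ℕ} {s : ℤ} {l : List HV} :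
    l ∈ brFin v M s ↔ l ∈ sawsUpTo v M ∧ IsBridgeOf s l := by
  classical
  rw [brFin, mem_filter]

/-- Weights are nonnegative for `x ≥ 0`. [folklore] -/
theorem wt_nonneg {x : ℝ} (hx : 0 ≤ x) (F : Finset (List HV)) : 0 ≤ wt x F :=
  sum_nonneg fun _ _ => pow_nonneg hx _

/-- Weights are monotone in the set for `x ≥ 0`. [folklore] -/
theorem wt_mono {x : ℝ} (hx : 0 ≤ x) {F G : Finset (List HV)} (h : F ⊆ G) : wt x F ≤ wt x G :=
  sum_le_sum_of_subset_of_nonneg h fun _ _ _ => pow_nonneg hx _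

/-- Weights add over disjoint unions. [folklore] -/
theorem wt_union {x : ℝ} {F G : Finset (List HV)} (h : Disjoint F G) : wt x (F ∪ G) = wt x F + wt x G :=
  sum_union h

/-- A half-space walk of at most `M` steps has span at most `M`. [folklore] -/
theorem spanLE_of_mem {v : HV} {M : ℕ} {l : List HV} (h : l ∈ sawsUpTo v M) : SpanLE M l := by
  intro i hi
  have hl := mem_sawsUpTo_iff.1 h
  have := lev_getElem_sub_le hl.1 (Nat.zero_le i) hi
  push_cast at this
  have : (i : ℤ) ≤ M := by have := hl.2.2.2; omega
  omega

/-! ### Every self-avoiding walk is a pair of half-space walks -/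

/-- A canonical lower neighbour of a vertex (one level down). [folklore] -/
def downOf (v : HV) : HV := if v.2.2 then (v.1, v.2.1, false) else (v.1, v.2.1 - 1, true)

/-- `downOf v ∼ v`. [folklore] -/
theorem adj_downOf (v : HV) : hvGraph.Adj (downOf v) v := by
  obtain ⟨a, b, c⟩ := v; cases c <;> simp [downOf, hvGraph_adj, AdjRel]

/-- `downOf v` is one level below `v`. [folklore] -/
@[simp] theorem lev_downOf (v : HV) : lev (downOf v) = lev v - 1 := by
  obtain ⟨a, b, c⟩ := v
  cases c
  · simp [downOf, lev, bit]; ring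
  · simp [downOf, lev, bit]

/-- The reversed initial piece of the Hammersley–Welsh splitting of a walk at the last visit `m`
to its lowest level, extended by one step down and standardised:
`toStd [downOf ω_m, ω_m, ω_{m-1}, …, ω_0]` ("(ω(m) - e₁, ω(m), …, ω(0)) is a half-space walk").
[cite: DuminilCopinSmirnov2012, §3 ("If γ is a self-avoiding walk in the plane, one can cut the
trajectory into two pieces")] -/
def hwFst (l : List HV) : List HV :=
  toStd (downOf (l.getD (lastArgmin l) hvOrigin) :: (l.take (lastArgmin l + 1)).reverse)

/-- The final piece `toStd [ω_m, …, ω_n]` of the Hammersley–Welsh splitting (a half-space walk).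
[cite: DuminilCopinSmirnov2012, §3] -/
def hwSnd (l : List HV) : List HV := toStd (l.drop (lastArgmin l))

/-- The standard half-space walks of at most `M` steps and span at most `S` (from `(0,0,0)` or
from `(0,0,1)`). [cite: DuminilCopinSmirnov2012, §3] -/
def hsBoth (M : ℕ) (S : ℤ) : Finset (List HV) := hsFin (stdPt false) M S ∪ hsFin (stdPt true) M S

/-- The standard half-space walks of at most `M` steps. [cite: DuminilCopinSmirnov2012, §3] -/
abbrev hsStd (M : ℕ) : Finset (List HV) := hsBoth M M

/-- `toStd` preserves the half-space property. [folklore] -/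
theorem isHalfSpace_toStd {l : List HV} (hh : IsHalfSpace l) : IsHalfSpace (toStd l) := by
  intro i hi hi0
  rw [lev_getElem_toStd, lev_getElem_toStd]
  have := hh i (by simpa using hi) hi0
  linarith

/-- `toStd` preserves span bounds. [folklore] -/
theorem spanLE_toStd {S : ℤ} {l : List HV} (hs : SpanLE S l) : SpanLE S (toStd l) := by
  intro i hi
  rw [lev_getElem_toStd, lev_getElem_toStd]
  have := hs i (by simpa using hi)
  linarith

/-- A half-space walk of at most `M` steps and span at most `S` from any vertex standardises into
`hsBoth M S`. [folklore] -/
theorem toStd_mem_hsBoth {v : HV} {M : ℕ} {S : ℤ} {l : List HV} (hl : l ∈ sawsUpTo v M)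
    (hh : IsHalfSpace l) (hs : SpanLE S l) : toStd l ∈ hsBoth M S := by
  have key : toStd l ∈ hsFin (stdPt v.2.2) M S :=
    mem_hsFin_iff.2 ⟨toStd_mem_sawsUpTo hl, isHalfSpace_toStd hh, spanLE_toStd hs⟩
  rw [hsBoth, mem_union]
  cases h : v.2.2
  · left; rwa [h] at key
  · right; rwa [h] at key

/-- A half-space walk of at most `M` steps from any vertex standardises into `hsStd M`. [folklore] -/
theorem toStd_mem_hsStd {v : HV} {M : ℕ} {l : List HV} (hl : l ∈ sawsUpTo v M) (hh : IsHalfSpace l) :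
    toStd l ∈ hsStd M :=
  toStd_mem_hsBoth hl hh (spanLE_of_mem hl)

section Chi

variable {N : ℕ} {l : List HV}

/-- The second piece is a standard half-space walk of at most `N` steps.
[cite: DuminilCopinSmirnov2012, §3] -/
theorem hwSnd_mem (hl : l ∈ sawsUpTo hvOrigin N) : hwSnd l ∈ hsStd N := by
  have hne := ne_nil_of_mem_sawsUpTo hl
  obtain ⟨hm, -, hstrict⟩ := lastArgmin_spec hne
  obtain ⟨hc, -, hnd, hlen⟩ := mem_sawsUpTo_iff.1 hl
  set m := lastArgmin l
  have hR : l.drop m ∈ sawsUpTo (l[m]) N := by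
    rw [mem_sawsUpTo_iff]
    refine ⟨hc.drop m, by rw [List.head?_drop, List.getElem?_eq_getElem hm], hnd.sublist (List.drop_sublist _ _), ?_⟩
    rw [List.length_drop]; omega
  refine toStd_mem_hsStd hR fun i hi hi0 => ?_
  simp only [List.getElem_drop, Nat.add_zero]
  exact hstrict _ _ (by omega)

/-- `downOf ω_m` is not on the walk (it lies below the lowest level). [folklore] -/
theorem downOf_not_mem (hl : l ∈ sawsUpTo hvOrigin N) :
    downOf (l.getD (lastArgmin l) hvOrigin) ∉ l := by
  have hne := ne_nil_of_mem_sawsUpTo hl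
  obtain ⟨hm, hmin, -⟩ := lastArgmin_spec hne
  rw [getD_eq_getElem' hm]
  intro hmeml
  obtain ⟨j, hj, hjeq⟩ := List.getElem_of_mem hmeml
  have h1 := hmin j hj
  have h2 := lev_downOf (l[lastArgmin l])
  rw [← hjeq] at h2
  omega

/-- The first piece is a standard half-space walk of at most `N + 1` steps.
[cite: DuminilCopinSmirnov2012, §3] -/
theorem hwFst_mem (hl : l ∈ sawsUpTo hvOrigin N) : hwFst l ∈ hsStd (N + 1) := by
  have hne := ne_nil_of_mem_sawsUpTo hl
  obtain ⟨hm, hmin, -⟩ := lastArgmin_spec hne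
  obtain ⟨hc, -, hnd, hlen⟩ := mem_sawsUpTo_iff.1 hl
  have hdn := downOf_not_mem hl
  rw [getD_eq_getElem' hm] at hdn
  have hF : hwFst l = toStd (downOf l[lastArgmin l] :: (l.take (lastArgmin l + 1)).reverse) := by
    rw [hwFst, getD_eq_getElem' hm]
  rw [hF]
  have htk : l.take (lastArgmin l + 1) ≠ [] := by simp [hne]
  have hQ : downOf l[lastArgmin l] :: (l.take (lastArgmin l + 1)).reverse ∈ sawsUpTo (downOf l[lastArgmin l]) (N + 1) := by
    rw [mem_sawsUpTo_iff]
    refine ⟨?_, rfl, ?_, ?_⟩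
    · rw [List.isChain_cons]
      constructor
      · intro b hb
        rw [List.head?_reverse, List.getLast?_eq_some_getLast htk, Option.mem_def,
          Option.some_inj] at hb
        subst hb
        rw [List.getLast_eq_getElem, List.getElem_take]
        simp only [List.length_take, Nat.min_eq_left (Nat.succ_le_of_lt hm)]
        exact adj_downOf _
      · rw [List.isChain_reverse]
        exact (hc.take _).imp fun x y (h : hvGraph.Adj x y) => h.symm
    · rw [List.nodup_cons, List.mem_reverse]
      exact ⟨fun h => hdn (List.mem_of_mem_take h),
        List.nodup_reverse.2 (hnd.sublist (List.take_sublist _ _))⟩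
    · simp only [List.length_cons, List.length_reverse, List.length_take]; omega
  refine toStd_mem_hsStd hQ fun i hi hi0 => ?_
  -- every later vertex of the first piece is a vertex of `l`, hence not below `ω_m`
  have hmemQ : (downOf l[lastArgmin l] :: (l.take (lastArgmin l + 1)).reverse)[i] ∈ (l.take (lastArgmin l + 1)).reverse := by
    obtain ⟨k, rfl⟩ : ∃ k, i = k + 1 := ⟨i - 1, by omega⟩
    rw [List.getElem_cons_succ]; exact List.getElem_mem _
  rw [List.mem_reverse] at hmemQ
  obtain ⟨j, hj, hjeq⟩ := List.getElem_of_mem (List.mem_of_mem_take hmemQ)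
  have h1 := hmin j hj
  rw [hjeq] at h1
  simp only [List.getElem_cons_zero, lev_downOf]
  omega

/-- Lengths of the two pieces. [folklore] -/
theorem length_hwFst_add (hl : l ∈ sawsUpTo hvOrigin N) :
    (hwFst l).length = lastArgmin l + 2 ∧ (hwSnd l).length = l.length - lastArgmin l ∧
      lastArgmin l < l.length := by
  obtain ⟨hm, -, -⟩ := lastArgmin_spec (ne_nil_of_mem_sawsUpTo hl)
  refine ⟨?_, by simp [hwSnd], hm⟩
  simp only [hwFst, length_toStd, List.length_cons, List.length_reverse, List.length_take]
  omega

/-- The Hammersley–Welsh splitting is injective on walks from `O` ("if one fixes the starting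
mid-edge and the first vertex visited, the decomposition uniquely determines the walk").
[cite: DuminilCopinSmirnov2012, §3] -/
theorem hw_injOn : Set.InjOn (fun l => (hwFst l, hwSnd l)) (sawsUpTo hvOrigin N : Set (List HV)) := by
  intro l hl l' hl' h
  simp only [Prod.mk.injEq] at h
  obtain ⟨h1, h2⟩ := h
  rw [mem_coe] at hl hl'
  have hne := ne_nil_of_mem_sawsUpTo hl
  have hne' := ne_nil_of_mem_sawsUpTo hl'
  obtain ⟨hL1, -, hm⟩ := length_hwFst_add hl
  obtain ⟨hL1', -, hm'⟩ := length_hwFst_add hl'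
  have hmm : lastArgmin l = lastArgmin l' := by
    have := congrArg List.length h1; omega
  set m := lastArgmin l
  -- the reversed initial pieces agree: both end at `O`
  have htk : l.take (m + 1) ≠ [] := by simp [hne]
  have htk' : l'.take (m + 1) ≠ [] := by simp [hne']
  have h0 : l[0]'(by omega) = hvOrigin := getElem_zero_of_mem_sawsUpTo hl _
  have h0' : l'[0]'(by omega) = hvOrigin := getElem_zero_of_mem_sawsUpTo hl' _
  have hQ : downOf (l.getD m hvOrigin) :: (l.take (m + 1)).reverse =
      downOf (l'.getD m hvOrigin) :: (l'.take (m + 1)).reverse := by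
    rw [hwFst, hwFst, ← hmm] at h1
    refine toStd_inj_of_getLast h1 (List.cons_ne_nil _ _) (List.cons_ne_nil _ _) ?_
    rw [List.getLast_cons (by simpa using htk), List.getLast_cons (by simpa using htk'),
      List.getLast_reverse, List.getLast_reverse, List.head_take, List.head_take,
      List.head_eq_getElem, List.head_eq_getElem, h0, h0']
  have htake : l.take (m + 1) = l'.take (m + 1) := by
    have := (List.cons.inj hQ).2
    rwa [List.reverse_inj] at this
  have hgm : l[m] = l'[m]'(by omega) := by
    have e1 : (l.take (m + 1))[m]? = l[m]? := List.getElem?_take_of_lt (by omega)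
    have e2 : (l'.take (m + 1))[m]? = l'[m]? := List.getElem?_take_of_lt (by omega)
    rw [htake] at e1
    have := e1.symm.trans e2
    rwa [List.getElem?_eq_getElem hm, List.getElem?_eq_getElem (by omega), Option.some_inj] at this
  have hdrop : l.drop m = l'.drop m := by
    rw [hwSnd, hwSnd, ← hmm] at h2
    refine toStd_inj_of_head h2 ?_
    rw [List.head?_drop, List.head?_drop, List.getElem?_eq_getElem hm,
      List.getElem?_eq_getElem (by omega), hgm]
  have htake' : l.take m = l'.take m := by
    have := congrArg (List.take m) htake
    rwa [List.take_take, List.take_take, min_eq_left (Nat.le_succ _)] at this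
  calc l = l.take m ++ l.drop m := (List.take_append_drop _ _).symm
    _ = l'.take m ++ l'.drop m := by rw [htake', hdrop]
    _ = l' := List.take_append_drop _ _

/-- `Σ_{n ≤ N} cₙ xⁿ` is the generating function of `sawsUpTo O N`. [folklore] -/
theorem sum_hexSawCount_eq_wt (N : ℕ) (x : ℝ) :
    ∑ n ∈ range (N + 1), (hexSawCount n : ℝ) * x ^ n = wt x (sawsUpTo hvOrigin N) := by
  rw [wt, sawsUpTo, sum_biUnion]
  · refine sum_congr rfl fun n _ => ?_
    rw [hexSawCount_eq_card, sum_congr rfl fun l hl => by rw [(mem_sawFin_iff.1 hl).2.2.1],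
      sum_const, nsmul_eq_mul]
    simp
  · intro n _ n' _ hnn
    simp only [Function.onFun, disjoint_left]
    intro l hl hl'
    rw [mem_sawFin_iff] at hl hl'
    exact hnn (by have := hl.2.2.1; have := hl'.2.2.1; omega)

/-- `hsStd` is monotone. [folklore] -/
theorem hsStd_mono {M M' : ℕ} (h : M ≤ M') : hsStd M ⊆ hsStd M' := by
  intro l hl
  simp only [hsStd, hsBoth, mem_union, mem_hsFin_iff] at hl ⊢
  rcases hl with ⟨h1, h2, h3⟩ | ⟨h1, h2, h3⟩
  · exact Or.inl ⟨sawsUpTo_mono h h1, h2, fun i hi => (h3 i hi).trans (by omega)⟩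
  · exact Or.inr ⟨sawsUpTo_mono h h1, h2, fun i hi => (h3 i hi).trans (by omega)⟩

/-- **`Σ_{n ≤ N} cₙ xⁿ ≤ x⁻¹ H_{N+1}(x)²`**, `H_M` the generating function of standard half-space
walks of at most `M` steps (`x > 0`): the Hammersley–Welsh splitting at the last visit to the
lowest level (Madras–Slade (3.1.11)). [cite: DuminilCopinSmirnov2012, §3 ("Z(x) ≤ … any
self-avoiding walk can be canonically decomposed")] -/
theorem sum_hexSawCount_le (N : ℕ) {x : ℝ} (hx : 0 < x) :
    ∑ n ∈ range (N + 1), (hexSawCount n : ℝ) * x ^ n ≤ x⁻¹ * wt x (hsStd (N + 1)) ^ 2 := by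
  rw [sum_hexSawCount_eq_wt, wt]
  have hw : ∀ l ∈ sawsUpTo hvOrigin N, x ^ (l.length - 1) =
      x⁻¹ * (x ^ ((hwFst l).length - 1) * x ^ ((hwSnd l).length - 1)) := by
    intro l hl
    obtain ⟨h1, h2, hm⟩ := length_hwFst_add hl
    rw [h1, h2, ← pow_add, show lastArgmin l + 2 - 1 + (l.length - lastArgmin l - 1) =
      (l.length - 1) + 1 by omega, pow_succ]
    field_simp
  rw [sum_congr rfl hw, ← mul_sum]
  refine mul_le_mul_of_nonneg_left ?_ (inv_nonneg.2 hx.le)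
  calc ∑ l ∈ sawsUpTo hvOrigin N, x ^ ((hwFst l).length - 1) * x ^ ((hwSnd l).length - 1)
      ≤ ∑ p ∈ hsStd (N + 1) ×ˢ hsStd N, x ^ (p.1.length - 1) * x ^ (p.2.length - 1) :=
        sum_le_sum_of_injOn_of_nonneg (fun l => (hwFst l, hwSnd l)) hw_injOn
          (fun l hl => mem_product.2 ⟨hwFst_mem hl, hwSnd_mem hl⟩)
          (fun p => x ^ (p.1.length - 1) * x ^ (p.2.length - 1)) fun _ _ => by positivity
    _ = wt x (hsStd (N + 1)) * wt x (hsStd N) := by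
        rw [sum_product, wt, wt, sum_mul_sum]
    _ ≤ wt x (hsStd (N + 1)) ^ 2 := by
        rw [sq]
        exact mul_le_mul_of_nonneg_left (wt_mono hx.le (hsStd_mono (Nat.le_succ N)))
          (wt_nonneg hx.le _)

end Chi

/-! ### Half-space walks decompose into bridges of decreasing widths -/

section Recurrence

variable {v : HV} {M S : ℕ} {l : List HV}

/-- The half-space walks of span exactly `S + 1`. [cite: DuminilCopinSmirnov2012, §3] -/
def hsExact (v : HV) (M S : ℕ) : Finset (List HV) :=
  open scoped Classical in (hsFin v M (S + 1)).filter fun l => ¬ SpanLE S l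

/-- `H_{≤ S+1} = H_{≤ S} + H_{= S+1}`. [folklore] -/
theorem wt_hsFin_succ (v : HV) (M S : ℕ) (x : ℝ) :
    wt x (hsFin v M (S + 1)) = wt x (hsFin v M S) + wt x (hsExact v M S) := by
  classical
  rw [wt, wt, wt, hsExact, ← sum_filter_add_sum_filter_not (hsFin v M (S + 1)) (fun l => SpanLE S l)]
  congr 2
  ext l
  simp only [mem_filter, mem_hsFin_iff]
  constructor
  · rintro ⟨⟨h1, h2, -⟩, h4⟩; exact ⟨h1, h2, h4⟩
  · rintro ⟨h1, h2, h3⟩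
    exact ⟨⟨h1, h2, fun i hi => (h3 i hi).trans (by linarith)⟩, h3⟩

/-- The first bridge: the walk up to the last visit to its highest level ("The `n` first vertices
of the walk form a bridge `γ̃₁` of width `T₀`"). [cite: DuminilCopinSmirnov2012, §3] -/
def brPart (l : List HV) : List HV := l.take (lastArgmax l + 1)

/-- The remainder after the first bridge, flipped and standardised (a half-space walk of smaller
span: "The consequent steps form a half-plane walk `γ̃₂` of width `T₁ < T₀`").
[cite: DuminilCopinSmirnov2012, §3] -/
def hsPart (l : List HV) : List HV := toStd ((l.drop (lastArgmax l)).map flip)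

/-- Anatomy of a half-space walk of span exactly `S + 1`. [folklore] -/
theorem hsExact_spec (hl : l ∈ hsExact v M S) :
    l ∈ sawsUpTo v M ∧ IsHalfSpace l ∧ SpanLE (S + 1 : ℕ) l ∧
      ∃ hk : lastArgmax l < l.length,
        (∀ (j : ℕ) (hj : j < l.length), lev l[j] ≤ lev l[lastArgmax l]) ∧
        (∀ (j : ℕ) (hj : j < l.length), lastArgmax l < j → lev l[j] < lev l[lastArgmax l]) ∧
        lev l[lastArgmax l] = lev (l[0]'(by omega)) + S + 1 := by
  classical
  rw [hsExact, mem_filter, mem_hsFin_iff] at hl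
  obtain ⟨⟨hmem, hh, hs⟩, hnot⟩ := hl
  have hne := ne_nil_of_mem_sawsUpTo hmem
  obtain ⟨hk, hmax, hstrict⟩ := lastArgmax_spec hne
  refine ⟨hmem, hh, by exact_mod_cast hs, hk, hmax, hstrict, le_antisymm ?_ ?_⟩
  · have := hs _ hk; linarith
  · unfold SpanLE at hnot
    push Not at hnot
    obtain ⟨i, hi, hlt⟩ := hnot
    have := hmax i hi
    linarith

/-- The first bridge is a bridge of width `S + 1` from `v` of at most `M` steps.
[cite: DuminilCopinSmirnov2012, §3] -/
theorem brPart_mem (hl : l ∈ hsExact v M S) : brPart l ∈ brFin v M (S + 1) := by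
  obtain ⟨hmem, hh, hs, hk, -, -, htop⟩ := hsExact_spec hl
  obtain ⟨hc, hhd, hnd, hlen⟩ := mem_sawsUpTo_iff.1 hmem
  have hne := ne_nil_of_mem_sawsUpTo hmem
  rw [mem_brFin_iff, brPart, mem_sawsUpTo_iff]
  refine ⟨⟨hc.take _, by rw [List.head?_take]; simpa using hhd, hnd.sublist (List.take_sublist _ _),
    by simp only [List.length_take]; omega⟩, ?_, ?_, ?_⟩
  · intro i hi hi0
    simp only [List.getElem_take]
    exact hh i (by simp at hi; omega) hi0
  · intro i hi
    simp only [List.getElem_take]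
    exact hs i (by simp at hi; omega)
  · intro h0
    simp only [List.getElem_take, List.length_take, Nat.min_eq_left (Nat.succ_le_of_lt hk)]
    push_cast
    linarith

/-- The remainder is a standard half-space walk of at most `M` steps and span at most `S`.
[cite: DuminilCopinSmirnov2012, §3] -/
theorem hsPart_mem (hl : l ∈ hsExact v M S) : hsPart l ∈ hsBoth M S := by
  obtain ⟨hmem, hh, -, hk, -, hstrict, htop⟩ := hsExact_spec hl
  obtain ⟨hc, -, hnd, hlen⟩ := mem_sawsUpTo_iff.1 hmem
  have hR : (l.drop (lastArgmax l)).map flip ∈ sawsUpTo (flip l[lastArgmax l]) M := by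
    rw [mem_sawsUpTo_iff]
    refine ⟨?_, ?_, ?_, ?_⟩
    · rw [List.isChain_map]; exact (hc.drop _).imp fun x y h => flip.map_rel_iff.2 h
    · rw [List.head?_map, List.head?_drop, List.getElem?_eq_getElem hk]; rfl
    · exact (hnd.sublist (List.drop_sublist _ _)).map flip.injective
    · simp only [List.length_map, List.length_drop]; omega
  refine toStd_mem_hsBoth hR ?_ ?_
  · intro i hi hi0
    simp only [List.getElem_map, List.getElem_drop, lev_flip, Nat.add_zero]
    have := hstrict (lastArgmax l + i) (by simp at hi; omega) (by omega)
    linarith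
  · intro i hi
    simp only [List.getElem_map, List.getElem_drop, lev_flip, Nat.add_zero]
    simp only [List.length_map, List.length_drop] at hi
    rcases Nat.eq_zero_or_pos (lastArgmax l + i) with h0 | hpos
    · have hi0 : i = 0 := by omega
      subst hi0
      simp
    · have := hh (lastArgmax l + i) (by omega) hpos
      linarith

/-- Lengths of the two pieces of a half-space walk. [folklore] -/
theorem length_brPart_add (hl : l ∈ hsExact v M S) :
    (brPart l).length = lastArgmax l + 1 ∧ (hsPart l).length = l.length - lastArgmax l ∧
      lastArgmax l < l.length := by
  obtain ⟨-, -, -, hk, -⟩ := hsExact_spec hl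
  refine ⟨?_, by simp [hsPart], hk⟩
  simp only [brPart, List.length_take]; omega

/-- The bridge decomposition step is injective (for a fixed starting vertex).
[cite: DuminilCopinSmirnov2012, §3 ("the decomposition uniquely determines the walk")] -/
theorem brPart_injOn : Set.InjOn (fun l => (brPart l, hsPart l)) (hsExact v M S : Set (List HV)) := by
  intro l hl l' hl' h
  simp only [Prod.mk.injEq] at h
  obtain ⟨h1, h2⟩ := h
  rw [mem_coe] at hl hl'
  obtain ⟨hL1, -, hk⟩ := length_brPart_add hl
  obtain ⟨hL1', -, hk'⟩ := length_brPart_add hl'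
  have hkk : lastArgmax l = lastArgmax l' := by
    have := congrArg List.length h1; omega
  rw [brPart, brPart, ← hkk] at h1
  have hgk : l[lastArgmax l] = l'[lastArgmax l]'(by omega) := by
    have e1 : (l.take (lastArgmax l + 1))[lastArgmax l]? = l[lastArgmax l]? :=
      List.getElem?_take_of_lt (by omega)
    have e2 : (l'.take (lastArgmax l + 1))[lastArgmax l]? = l'[lastArgmax l]? :=
      List.getElem?_take_of_lt (by omega)
    rw [h1] at e1
    have := e1.symm.trans e2
    rwa [List.getElem?_eq_getElem hk, List.getElem?_eq_getElem (by omega), Option.some_inj] at this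
  have hdrop : l.drop (lastArgmax l) = l'.drop (lastArgmax l) := by
    rw [hsPart, hsPart, ← hkk] at h2
    have h3 := toStd_inj_of_head h2 (by
      rw [List.head?_map, List.head?_map, List.head?_drop, List.head?_drop,
        List.getElem?_eq_getElem hk, List.getElem?_eq_getElem (by omega), hgk])
    exact (List.map_injective_iff.2 flip.injective) h3
  have htake : l.take (lastArgmax l) = l'.take (lastArgmax l) := by
    have := congrArg (List.take (lastArgmax l)) h1
    rwa [List.take_take, List.take_take, min_eq_left (Nat.le_succ _)] at this
  calc l = l.take (lastArgmax l) ++ l.drop (lastArgmax l) := (List.take_append_drop _ _).symm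
    _ = l'.take (lastArgmax l) ++ l'.drop (lastArgmax l) := by rw [htake, hdrop]
    _ = l' := List.take_append_drop _ _

/-- `H_{= S+1}(v) ≤ B_{S+1}(v) · H_{≤ S}(std)` (`x ≥ 0`). [cite: DuminilCopinSmirnov2012, §3] -/
theorem wt_hsExact_le (v : HV) (M S : ℕ) {x : ℝ} (hx : 0 ≤ x) :
    wt x (hsExact v M S) ≤ wt x (brFin v M (S + 1)) * wt x (hsBoth M S) := by
  rw [wt]
  have hw : ∀ l ∈ hsExact v M S, x ^ (l.length - 1) =
      x ^ ((brPart l).length - 1) * x ^ ((hsPart l).length - 1) := by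
    intro l hl
    obtain ⟨h1, h2, hk⟩ := length_brPart_add hl
    rw [h1, h2, ← pow_add]
    congr 1; omega
  rw [sum_congr rfl hw]
  calc ∑ l ∈ hsExact v M S, x ^ ((brPart l).length - 1) * x ^ ((hsPart l).length - 1)
      ≤ ∑ p ∈ brFin v M (S + 1) ×ˢ hsBoth M S, x ^ (p.1.length - 1) * x ^ (p.2.length - 1) :=
        sum_le_sum_of_injOn_of_nonneg (fun l => (brPart l, hsPart l)) brPart_injOn
          (fun l hl => mem_product.2 ⟨brPart_mem hl, hsPart_mem hl⟩)
          (fun p => x ^ (p.1.length - 1) * x ^ (p.2.length - 1)) fun _ _ => by positivity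
    _ = wt x (brFin v M (S + 1)) * wt x (hsBoth M S) := by rw [sum_product, wt, wt, sum_mul_sum]

/-- `H_{≤ S}` summed over the two standard starting vertices. [cite: DuminilCopinSmirnov2012, §3] -/
def hSum (M S : ℕ) (x : ℝ) : ℝ := wt x (hsFin (stdPt false) M S) + wt x (hsFin (stdPt true) M S)

/-- The bridge generating function of width `s`, summed over the two standard starting vertices.
[cite: DuminilCopinSmirnov2012, §3] -/
def bSum (M : ℕ) (s : ℤ) (x : ℝ) : ℝ := wt x (brFin (stdPt false) M s) + wt x (brFin (stdPt true) M s)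

/-- `wt (hsBoth M S) = hSum M S`. [folklore] -/
theorem wt_hsBoth (M S : ℕ) (x : ℝ) : wt x (hsBoth M S) = hSum M S x := by
  rw [hsBoth, hSum, wt_union]
  classical
  exact disjoint_filter_filter (disjoint_sawsUpTo (by simp [stdPt]) M M)

/-- `bSum ≥ 0`. [folklore] -/
theorem bSum_nonneg (M : ℕ) (s : ℤ) {x : ℝ} (hx : 0 ≤ x) : 0 ≤ bSum M s x :=
  add_nonneg (wt_nonneg hx _) (wt_nonneg hx _)

/-- `hSum ≥ 0`. [folklore] -/
theorem hSum_nonneg (M S : ℕ) {x : ℝ} (hx : 0 ≤ x) : 0 ≤ hSum M S x :=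
  add_nonneg (wt_nonneg hx _) (wt_nonneg hx _)

/-- **The span recurrence** `H_{≤ S+1} ≤ H_{≤ S} (1 + B_{S+1})`. [cite: DuminilCopinSmirnov2012, §3
("we prove by induction on the width T₀ that the walk admits a canonical decomposition into
bridges of widths T₀ > ⋯ > T_j")] -/
theorem hSum_succ_le (M S : ℕ) {x : ℝ} (hx : 0 ≤ x) :
    hSum M (S + 1) x ≤ hSum M S x * (1 + bSum M (S + 1) x) := by
  have h0 := wt_hsFin_succ (stdPt false) M S x
  have h1 := wt_hsFin_succ (stdPt true) M S x
  have e0 := wt_hsExact_le (stdPt false) M S hx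
  have e1 := wt_hsExact_le (stdPt true) M S hx
  rw [wt_hsBoth] at e0 e1
  simp only [hSum, bSum] at *
  push_cast at h0 h1 ⊢
  rw [h0, h1]
  nlinarith [wt_nonneg hx (hsFin (stdPt false) M S), wt_nonneg hx (hsFin (stdPt true) M S),
    wt_nonneg hx (brFin (stdPt false) M (S + 1)), wt_nonneg hx (brFin (stdPt true) M (S + 1))]

/-- A half-space walk of span `0` is trivial: `hsFin v M 0 ⊆ {[v]}`. [folklore] -/
theorem hsFin_zero_subset (v : HV) (M : ℕ) : hsFin v M 0 ⊆ {[v]} := by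
  intro l hl
  rw [mem_hsFin_iff] at hl
  obtain ⟨hmem, hh, hs⟩ := hl
  obtain ⟨-, hhd, -, -⟩ := mem_sawsUpTo_iff.1 hmem
  rw [mem_singleton]
  match l, hhd with
  | [a], hhd => simpa using hhd
  | a :: b :: l, hhd =>
    exfalso
    have h1 := hh 1 (by simp) Nat.one_pos
    have h2 := hs 1 (by simp)
    simp at h1 h2
    linarith

/-- `H_{≤ 0} ≤ 2` (`x ≥ 0`). [folklore] -/
theorem hSum_zero_le (M : ℕ) {x : ℝ} (hx : 0 ≤ x) : hSum M 0 x ≤ 2 := by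
  have key : ∀ v : HV, wt x (hsFin v M 0) ≤ 1 := fun v =>
    (wt_mono hx (hsFin_zero_subset v M)).trans (by simp [wt])
  have := key (stdPt false)
  have := key (stdPt true)
  rw [hSum]; push_cast; linarith

/-- **`H_{≤ S} ≤ 2 ∏_{s=1}^{S} (1 + B_s)`** (Hammersley–Welsh). [cite: DuminilCopinSmirnov2012, §3] -/
theorem hSum_le_prod (M S : ℕ) {x : ℝ} (hx : 0 ≤ x) :
    hSum M S x ≤ 2 * ∏ s ∈ range S, (1 + bSum M (s + 1) x) := by
  induction S with
  | zero => simpa using hSum_zero_le M hx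
  | succ S ih =>
    rw [prod_range_succ, ← mul_assoc]
    refine (hSum_succ_le M S hx).trans ?_
    exact mul_le_mul_of_nonneg_right ih (by linarith [bSum_nonneg M ((S : ℤ) + 1) hx])

end Recurrence

/-! ### Bridges from the standard vertices versus the strip partition functions `B_{T,L}` -/

section Compare

variable {x : ℝ}

/-- Level and horizontal bounds place a vertex in the trapezoid `S_{T,M}`. [folklore] -/
theorem mem_stripV_of_bounds {T M : ℕ} {w : HV} (h0 : 0 ≤ lev w) (h1 : lev w ≤ 2 * T - 1)
    (h2 : |w.1| ≤ M) : w ∈ stripV T M := by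
  rw [mem_stripV_iff]
  obtain ⟨p, q, c⟩ := w
  rw [abs_le] at h2
  cases c <;> simp [lev, bit] at h0 h1 h2 ⊢ <;> omega

/-- A bridge of odd width `2T - 1` from `O` is a bridge of the strip `S_{T,M}` in the sense of
`bridgeLists`. [cite: DuminilCopinSmirnov2012, §3 ("The partition function of bridges of width T
is B_T")] -/
theorem brFin_subset_bridgeLists {T : ℕ} (hT : 1 ≤ T) (M : ℕ) :
    brFin hvOrigin M (2 * (T : ℤ) - 1) ⊆ bridgeLists T M := by
  intro l hl
  rw [mem_brFin_iff] at hl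
  obtain ⟨hmem, hh, hs, hlast⟩ := hl
  have hne := ne_nil_of_mem_sawsUpTo hmem
  have hpos : 0 < l.length := List.length_pos_iff.2 hne
  have h0 : l[0] = hvOrigin := getElem_zero_of_mem_sawsUpTo hmem hpos
  obtain ⟨hc, hhd, hnd, hlen⟩ := mem_sawsUpTo_iff.1 hmem
  rw [mem_bridgeLists_iff hT]
  refine ⟨hc, hhd, hnd, fun w hw => ?_, hne, ?_⟩
  · obtain ⟨i, hi, rfl⟩ := List.getElem_of_mem hw
    have hlo : 0 ≤ lev l[i] := by
      rcases Nat.eq_zero_or_pos i with rfl | hi0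
      · rw [h0]; decide
      · have := hh i hi hi0; rw [h0] at this; simp at this; omega
    have hhi : lev l[i] ≤ 2 * T - 1 := by have := hs i hi; rw [h0] at this; simpa using this
    have habs := abs_fst_sub_le hc (Nat.zero_le i) hi
    rw [h0] at habs
    refine mem_stripV_of_bounds hlo hhi ?_
    simp only [hvOrigin, sub_zero, Nat.cast_zero] at habs
    exact habs.trans (by exact_mod_cast (by omega : i ≤ M))
  · rw [List.getLast_eq_getElem]
    have := hlast hpos
    rw [h0] at this
    simpa using this

/-- `Σ_{bridges of width 2T-1 from O, ≤ M steps} x^{#steps} ≤ x⁻¹ B_{T,M}(x)` (`x > 0`; the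
walk `a → β` has one more vertex than steps of its bridge). [cite: DuminilCopinSmirnov2012, §3] -/
theorem wt_brFin_odd_le {T : ℕ} (hT : 1 ≤ T) (M : ℕ) (hx : 0 < x) :
    wt x (brFin hvOrigin M (2 * (T : ℤ) - 1)) ≤ x⁻¹ * stripB T M x := by
  rw [stripB_eq_sum_bridgeLists hT, wt, mul_sum]
  have : ∀ l ∈ brFin hvOrigin M (2 * (T : ℤ) - 1), x ^ (l.length - 1) = x⁻¹ * x ^ l.length := by
    intro l hl
    have hpos : 0 < l.length :=
      List.length_pos_iff.2 (ne_nil_of_mem_sawsUpTo (mem_brFin_iff.1 hl).1)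
    rw [eq_inv_mul_iff_mul_eq₀ hx.ne', ← pow_succ', Nat.sub_add_cancel hpos]
  rw [sum_congr rfl this]
  exact sum_le_sum_of_subset_of_nonneg (brFin_subset_bridgeLists hT M) fun _ _ _ => by positivity

/-- The up-neighbour of a vertex of type `0` across its horizontal edge. [folklore] -/
def upNb (v : HV) : HV := (v.1, v.2.1, true)

/-- A bridge of even width `2T` from `O` extends by one step up to a bridge of width `2T + 1`:
`Σ x^{#steps} ≤ x⁻¹ Σ_{width 2T+1, ≤ M+1 steps} x^{#steps}` (`x > 0`).
[cite: DuminilCopinSmirnov2012, §3] -/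
theorem wt_brFin_even_le (T M : ℕ) (hx : 0 < x) :
    wt x (brFin hvOrigin M (2 * (T : ℤ))) ≤ x⁻¹ * wt x (brFin hvOrigin (M + 1) (2 * (T : ℤ) + 1)) := by
  rw [wt, wt, mul_sum]
  -- the extension map
  set e : List HV → List HV := fun l => l ++ [upNb (l.getLast?.getD hvOrigin)] with he
  have hw : ∀ l ∈ brFin hvOrigin M (2 * (T : ℤ)), x ^ (l.length - 1) = x⁻¹ * x ^ ((e l).length - 1) := by
    intro l hl
    have hpos : 0 < l.length :=
      List.length_pos_iff.2 (ne_nil_of_mem_sawsUpTo (mem_brFin_iff.1 hl).1)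
    rw [he]; dsimp only
    rw [List.length_append, List.length_singleton, Nat.add_sub_cancel, eq_inv_mul_iff_mul_eq₀ hx.ne',
      ← pow_succ', Nat.sub_add_cancel hpos]
  rw [sum_congr rfl hw]
  refine sum_le_sum_of_injOn_of_nonneg e ?_ ?_ (fun l => x⁻¹ * x ^ (l.length - 1))
    fun _ _ => by positivity
  · intro l _ l' _ h
    have := congrArg List.dropLast h
    simpa [he] using this
  · intro l hl
    rw [mem_brFin_iff] at hl
    obtain ⟨hmem, hh, hs, hlast⟩ := hl
    have hne := ne_nil_of_mem_sawsUpTo hmem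
    have hpos : 0 < l.length := List.length_pos_iff.2 hne
    have h0 : l[0] = hvOrigin := getElem_zero_of_mem_sawsUpTo hmem hpos
    obtain ⟨hc, hhd, hnd, hlen⟩ := mem_sawsUpTo_iff.1 hmem
    have hlast' := hlast hpos
    rw [h0, ← List.getLast_eq_getElem hne] at hlast'
    simp only [lev_hvOrigin, zero_add] at hlast'
    -- the last vertex has type `0`, and `u` sits right above it
    set z := l.getLast hne with hz
    have hu : e l = l ++ [upNb z] := by
      rw [he]; dsimp only; rw [List.getLast?_eq_some_getLast hne, Option.getD_some]
    have htyp : z.2.2 = false := by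
      obtain ⟨p, q, c⟩ := z; cases c; · rfl
      · simp [lev, bit] at hlast'; omega
    have hadj : hvGraph.Adj z (upNb z) := by
      obtain ⟨p, q, c⟩ := z; simp only at htyp; subst htyp; simp [upNb, hvGraph_adj, AdjRel]
    have hlevu : lev (upNb z) = 2 * T + 1 := by
      obtain ⟨p, q, c⟩ := z; simp only at htyp; subst htyp
      simp [upNb, lev, bit] at hlast' ⊢; omega
    have hlevl : ∀ (i : ℕ) (hi : i < l.length), lev l[i] ≤ 2 * T := by
      intro i hi; have := hs i hi; rw [h0] at this; simpa using this
    rw [hu, mem_brFin_iff, mem_sawsUpTo_iff]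
    refine ⟨⟨?_, ?_, ?_, ?_⟩, ?_, ?_, ?_⟩
    · exact hc.append (List.isChain_singleton _) fun a ha b hb => by
        rw [List.getLast?_eq_some_getLast hne, Option.mem_def, Option.some_inj] at ha
        simp only [List.head?_cons, Option.mem_def, Option.some_inj] at hb
        subst ha; subst hb; exact hadj
    · rw [List.head?_append, hhd]; rfl
    · rw [List.nodup_append]
      refine ⟨hnd, List.nodup_singleton _, fun a ha b hb => ?_⟩
      rw [List.mem_singleton] at hb
      subst hb
      obtain ⟨i, hi, rfl⟩ := List.getElem_of_mem ha
      intro hab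
      have := hlevl i hi
      rw [hab, hlevu] at this
      omega
    · simp only [List.length_append, List.length_singleton]; omega
    · intro i hi hi0
      simp only [List.length_append, List.length_singleton] at hi
      have e0 : (l ++ [upNb z])[0]'(by simp) = l[0] := List.getElem_append_left hpos
      rw [e0, h0]
      rcases Nat.lt_or_ge i l.length with hil | hil
      · rw [List.getElem_append_left hil]
        have := hh i hil hi0; rwa [h0] at this
      · rw [List.getElem_append_right hil]
        simp only [show i - l.length = 0 by omega, List.getElem_cons_zero, hlevu, lev_hvOrigin]
        omega
    · intro i hi
      simp only [List.length_append, List.length_singleton] at hi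
      have e0 : (l ++ [upNb z])[0]'(by simp) = l[0] := List.getElem_append_left hpos
      rw [e0, h0]
      rcases Nat.lt_or_ge i l.length with hil | hil
      · rw [List.getElem_append_left hil]
        have := hlevl i hil; simp; omega
      · rw [List.getElem_append_right hil]
        simp only [show i - l.length = 0 by omega, List.getElem_cons_zero, hlevu, lev_hvOrigin]
        omega
    · intro hp
      have e0 : (l ++ [upNb z])[0]'(by simp) = l[0] := List.getElem_append_left hpos
      rw [e0, h0]
      simp only [List.length_append, List.length_singleton, Nat.add_sub_cancel]
      rw [List.getElem_append_right le_rfl]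
      simp [hlevu]

/-- A bridge from `O' = (0,0,1)` extends one step down to a bridge from `O`:
`Σ x^{#steps} ≤ x⁻¹ Σ_{width s+1 from O, ≤ M+1 steps} x^{#steps}` (`x > 0`).
[cite: DuminilCopinSmirnov2012, §3] -/
theorem wt_brFin_true_le (s : ℤ) (M : ℕ) (hx : 0 < x) :
    wt x (brFin (stdPt true) M s) ≤ x⁻¹ * wt x (brFin hvOrigin (M + 1) (s + 1)) := by
  rw [wt, wt, mul_sum]
  have hw : ∀ l ∈ brFin (stdPt true) M s, x ^ (l.length - 1) =
      x⁻¹ * x ^ ((hvOrigin :: l).length - 1) := by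
    intro l hl
    have hpos : 0 < l.length :=
      List.length_pos_iff.2 (ne_nil_of_mem_sawsUpTo (mem_brFin_iff.1 hl).1)
    rw [List.length_cons, Nat.add_sub_cancel, eq_inv_mul_iff_mul_eq₀ hx.ne', ← pow_succ',
      Nat.sub_add_cancel hpos]
  rw [sum_congr rfl hw]
  refine sum_le_sum_of_injOn_of_nonneg (fun l => hvOrigin :: l) (fun l _ l' _ h => List.tail_eq_of_cons_eq h)
    ?_ (fun l => x⁻¹ * x ^ (l.length - 1)) fun _ _ => by positivity
  intro l hl
  rw [mem_brFin_iff] at hl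
  obtain ⟨hmem, hh, hs, hlast⟩ := hl
  have hne := ne_nil_of_mem_sawsUpTo hmem
  have hpos : 0 < l.length := List.length_pos_iff.2 hne
  have h0 : l[0] = stdPt true := getElem_zero_of_mem_sawsUpTo hmem hpos
  obtain ⟨hc, hhd, hnd, hlen⟩ := mem_sawsUpTo_iff.1 hmem
  have hlev1 : ∀ (i : ℕ) (hi : i < l.length), 1 ≤ lev l[i] := by
    intro i hi
    rcases Nat.eq_zero_or_pos i with rfl | hi0
    · rw [h0]; decide
    · have := hh i hi hi0; rw [h0, lev_stdPt_true] at this; omega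
  rw [mem_brFin_iff, mem_sawsUpTo_iff]
  refine ⟨⟨?_, rfl, ?_, by simp only [List.length_cons]; omega⟩, ?_, ?_, ?_⟩
  · rw [List.isChain_cons]
    refine ⟨fun b hb => ?_, hc⟩
    rw [hhd, Option.mem_def, Option.some_inj] at hb
    subst hb; decide
  · rw [List.nodup_cons]
    refine ⟨fun hO => ?_, hnd⟩
    obtain ⟨i, hi, hiO⟩ := List.getElem_of_mem hO
    have := hlev1 i hi
    rw [hiO] at this
    simp at this
  · intro i hi hi0
    obtain ⟨k, rfl⟩ : ∃ k, i = k + 1 := ⟨i - 1, by omega⟩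
    simp only [List.getElem_cons_zero, List.getElem_cons_succ, lev_hvOrigin]
    have := hlev1 k (by simpa using hi)
    omega
  · intro i hi
    simp only [List.getElem_cons_zero, lev_hvOrigin]
    rcases Nat.eq_zero_or_pos i with rfl | hi0
    · simp only [List.getElem_cons_zero, lev_hvOrigin]
      have := hlev1 0 hpos
      have := hs 0 hpos
      omega
    · obtain ⟨k, rfl⟩ : ∃ k, i = k + 1 := ⟨i - 1, by omega⟩
      simp only [List.getElem_cons_succ]
      have := hs k (by simpa using hi)
      rw [h0, lev_stdPt_true] at this
      omega
  · intro hp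
    rw [← List.getLast_eq_getElem (List.cons_ne_nil _ _), List.getLast_cons hne,
      List.getLast_eq_getElem, List.getElem_cons_zero, lev_hvOrigin]
    have := hlast hpos
    rw [h0, lev_stdPt_true] at this
    omega

/-- Bridges are at least as long as they are wide: `B_{T,L}(x) ≤ (x/y)^{2T} B_{T,L}(y)` for
`0 ≤ x ≤ y`, `0 < y` ("a bridge of width T has length at least T").
[cite: DuminilCopinSmirnov2012, §3 ("B_T^x ≤ (x/x_c)^T B_T^{x_c}")] -/
theorem stripB_le_pow_mul {T : ℕ} (hT : 1 ≤ T) (L : ℕ) {x y : ℝ} (hx : 0 ≤ x) (hxy : x ≤ y)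
    (hy : 0 < y) : stripB T L x ≤ (x / y) ^ (2 * T) * stripB T L y := by
  rw [stripB_eq_sum_bridgeLists hT, stripB_eq_sum_bridgeLists hT, mul_sum]
  refine sum_le_sum fun l hl => ?_
  obtain ⟨hc, hh, -, -, hne, hlev⟩ := (mem_bridgeLists_iff hT).1 hl
  have hlen : 2 * T ≤ l.length := by
    have hpos : 0 < l.length := List.length_pos_iff.2 hne
    have h1 := lev_getElem_sub_le hc (Nat.zero_le _) (Nat.sub_one_lt_of_lt hpos)
    rw [← List.getLast_eq_getElem hne, hlev] at h1
    have h0 : l[0] = hvOrigin := by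
      rw [List.head?_eq_getElem?, List.getElem?_eq_getElem hpos, Option.some_inj] at hh; exact hh
    rw [h0, lev_hvOrigin] at h1
    push_cast at h1
    omega
  have hρ : x / y ≤ 1 := (div_le_one hy).2 hxy
  have hρ0 : 0 ≤ x / y := div_nonneg hx hy.le
  calc x ^ l.length = (x / y) ^ l.length * y ^ l.length := by
        rw [← mul_pow, div_mul_cancel₀ _ hy.ne']
    _ ≤ (x / y) ^ (2 * T) * y ^ l.length :=
        mul_le_mul_of_nonneg_right (pow_le_pow_of_le_one hρ0 hρ hlen) (by positivity)

end Compare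

end HV

/-! ### Consequences of Lemma 2: exponential decay of bridges, `Z(x) < ∞` for `x < x_c` -/

section UpperBound

open HV

variable (hlem : DuminilCopinSmirnov2012_lemma2)
include hlem

/-- Under Lemma 2: `B_{T,L}(x) ≤ (x/x_c)^{2T}` for `0 ≤ x ≤ x_c` ("B_T^x ≤ (x/x_c)^T B_T^{x_c} ≤
(x/x_c)^T"). [cite: DuminilCopinSmirnov2012, §3] -/
theorem stripB_le_pow {T : ℕ} (hT : 1 ≤ T) (L : ℕ) {x : ℝ} (hx : 0 ≤ x) (hxc : x ≤ hexCriticalFugacity) :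
    stripB T L x ≤ (x / hexCriticalFugacity) ^ (2 * T) :=
  (stripB_le_pow_mul hT L hx hxc hexCriticalFugacity_pos_lt_one.1).trans
    (mul_le_of_le_one_right (pow_nonneg (div_nonneg hx hexCriticalFugacity_pos_lt_one.1.le) _)
      (stripB_le_one_of_lemma2 hlem hT L))

/-- Under Lemma 2: bridges of width `s ≥ 1` from `O` decay like `(x/x_c)^s`:
`Σ x^{#steps} ≤ x⁻² (x/x_c)^s` for `0 < x ≤ x_c`. [cite: DuminilCopinSmirnov2012, §3] -/
theorem wt_brFin_origin_le {s : ℕ} (hs : 1 ≤ s) (M : ℕ) {x : ℝ} (hx : 0 < x)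
    (hxc : x ≤ hexCriticalFugacity) :
    wt x (brFin hvOrigin M s) ≤ x⁻¹ ^ 2 * (x / hexCriticalFugacity) ^ s := by
  have hx1 : x ≤ 1 := hxc.trans hexCriticalFugacity_pos_lt_one.2.le
  have hρ : x / hexCriticalFugacity ≤ 1 := (div_le_one hexCriticalFugacity_pos_lt_one.1).2 hxc
  have hρ0 : 0 ≤ x / hexCriticalFugacity := div_nonneg hx.le hexCriticalFugacity_pos_lt_one.1.le
  have hinv1 : 1 ≤ x⁻¹ := (one_le_inv₀ hx).2 hx1
  rcases Nat.even_or_odd s with ⟨T, hT⟩ | ⟨T, hT⟩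
  · -- even width `2T`, `T ≥ 1`
    have hT1 : 1 ≤ T := by omega
    have h1 := wt_brFin_even_le T M hx
    have h2 := wt_brFin_odd_le (T := T + 1) (by omega) (M + 1) hx
    have h3 := stripB_le_pow hlem (T := T + 1) (by omega) (M + 1) hx.le hxc
    have e : (2 * ((T + 1 : ℕ) : ℤ) - 1) = 2 * (T : ℤ) + 1 := by push_cast; ring
    rw [e] at h2
    have hs' : (s : ℤ) = 2 * (T : ℤ) := by rw [hT]; push_cast; ring
    rw [hs']
    calc wt x (brFin hvOrigin M (2 * (T : ℤ)))
        ≤ x⁻¹ * (x⁻¹ * (x / hexCriticalFugacity) ^ (2 * (T + 1))) := by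
          refine h1.trans (mul_le_mul_of_nonneg_left (h2.trans ?_) (inv_nonneg.2 hx.le))
          exact mul_le_mul_of_nonneg_left h3 (inv_nonneg.2 hx.le)
      _ ≤ x⁻¹ ^ 2 * (x / hexCriticalFugacity) ^ s := by
          rw [← mul_assoc, ← sq]
          exact mul_le_mul_of_nonneg_left (pow_le_pow_of_le_one hρ0 hρ (by omega)) (by positivity)
  · -- odd width `2T + 1 = 2(T+1) - 1`
    have h2 := wt_brFin_odd_le (T := T + 1) (by omega) M hx
    have h3 := stripB_le_pow hlem (T := T + 1) (by omega) M hx.le hxc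
    have e : (2 * ((T + 1 : ℕ) : ℤ) - 1) = ((s : ℕ) : ℤ) := by rw [hT]; push_cast; ring
    rw [e] at h2
    calc wt x (brFin hvOrigin M s) ≤ x⁻¹ * (x / hexCriticalFugacity) ^ (2 * (T + 1)) :=
          h2.trans (mul_le_mul_of_nonneg_left h3 (inv_nonneg.2 hx.le))
      _ ≤ x⁻¹ ^ 2 * (x / hexCriticalFugacity) ^ s := by
          refine mul_le_mul ?_ (pow_le_pow_of_le_one hρ0 hρ (by omega)) (by positivity) (by positivity)
          rw [sq]; exact le_mul_of_one_le_right (inv_nonneg.2 hx.le) hinv1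

/-- Under Lemma 2: `bSum M s x ≤ 2 x⁻³ (x/x_c)^s` for `s ≥ 1`, `0 < x ≤ x_c`.
[cite: DuminilCopinSmirnov2012, §3] -/
theorem bSum_le {s : ℕ} (hs : 1 ≤ s) (M : ℕ) {x : ℝ} (hx : 0 < x) (hxc : x ≤ hexCriticalFugacity) :
    bSum M s x ≤ 2 * x⁻¹ ^ 3 * (x / hexCriticalFugacity) ^ s := by
  have hx1 : x ≤ 1 := hxc.trans hexCriticalFugacity_pos_lt_one.2.le
  have hρ : x / hexCriticalFugacity ≤ 1 := (div_le_one hexCriticalFugacity_pos_lt_one.1).2 hxc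
  have hρ0 : 0 ≤ x / hexCriticalFugacity := div_nonneg hx.le hexCriticalFugacity_pos_lt_one.1.le
  have hinv1 : 1 ≤ x⁻¹ := (one_le_inv₀ hx).2 hx1
  have h1 := wt_brFin_origin_le hlem hs M hx hxc
  have h2 := wt_brFin_true_le (s : ℤ) M hx
  have h3 := wt_brFin_origin_le hlem (s := s + 1) (by omega) (M + 1) hx hxc
  push_cast at h3
  rw [bSum]
  have hρs : (x / hexCriticalFugacity) ^ (s + 1) ≤ (x / hexCriticalFugacity) ^ s :=
    pow_le_pow_of_le_one hρ0 hρ (Nat.le_succ s)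
  have hi2 : x⁻¹ ^ 2 ≤ x⁻¹ ^ 3 := pow_le_pow_right₀ hinv1 (by norm_num)
  have hpos : 0 ≤ (x / hexCriticalFugacity) ^ s := by positivity
  have hipos : 0 ≤ x⁻¹ := inv_nonneg.2 hx.le
  calc wt x (brFin (stdPt false) M s) + wt x (brFin (stdPt true) M s)
      ≤ x⁻¹ ^ 2 * (x / hexCriticalFugacity) ^ s + x⁻¹ * (x⁻¹ ^ 2 * (x / hexCriticalFugacity) ^ (s + 1)) :=
        add_le_add h1 (h2.trans (mul_le_mul_of_nonneg_left h3 hipos))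
    _ ≤ x⁻¹ ^ 3 * (x / hexCriticalFugacity) ^ s + x⁻¹ ^ 3 * (x / hexCriticalFugacity) ^ s := by
        refine add_le_add (mul_le_mul_of_nonneg_right hi2 hpos) ?_
        rw [← mul_assoc, ← pow_succ']
        exact mul_le_mul_of_nonneg_left hρs (by positivity)
    _ = 2 * x⁻¹ ^ 3 * (x / hexCriticalFugacity) ^ s := by ring

/-- Under Lemma 2: `∏_{s=1}^{S} (1 + bSum M s x) ≤ exp(2x⁻³ ρ/(1-ρ))`, `ρ = x/x_c < 1` ("the series
`Σ_T B_T^x` converges and so does the product `∏_T (1 + B_T^x)`").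
[cite: DuminilCopinSmirnov2012, §3] -/
theorem prod_bSum_le (M S : ℕ) {x : ℝ} (hx : 0 < x) (hxc : x < hexCriticalFugacity) :
    ∏ s ∈ range S, (1 + bSum M (s + 1) x) ≤
      Real.exp (2 * x⁻¹ ^ 3 * ((x / hexCriticalFugacity) * (1 - x / hexCriticalFugacity)⁻¹)) := by
  set ρ := x / hexCriticalFugacity with hρ
  have hρ1 : ρ < 1 := (div_lt_one hexCriticalFugacity_pos_lt_one.1).2 hxc
  have hρ0 : 0 ≤ ρ := div_nonneg hx.le hexCriticalFugacity_pos_lt_one.1.le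
  have hb : ∀ s ∈ range S, 1 + bSum M (s + 1) x ≤ Real.exp (2 * x⁻¹ ^ 3 * ρ ^ (s + 1)) := by
    intro s _
    have := bSum_le hlem (s := s + 1) (by omega) M hx hxc.le
    push_cast at this
    linarith [Real.add_one_le_exp (2 * x⁻¹ ^ 3 * ρ ^ (s + 1))]
  calc ∏ s ∈ range S, (1 + bSum M (s + 1) x)
      ≤ ∏ s ∈ range S, Real.exp (2 * x⁻¹ ^ 3 * ρ ^ (s + 1)) :=
        prod_le_prod (fun s _ => by linarith [bSum_nonneg M ((s : ℤ) + 1) hx.le]) hb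
    _ = Real.exp (∑ s ∈ range S, 2 * x⁻¹ ^ 3 * ρ ^ (s + 1)) := (Real.exp_sum _ _).symm
    _ ≤ Real.exp (2 * x⁻¹ ^ 3 * (ρ * (1 - ρ)⁻¹)) := by
        apply Real.exp_le_exp.2
        rw [← mul_sum]
        refine mul_le_mul_of_nonneg_left ?_ (by positivity)
        have hgeom : ∑ s ∈ range S, ρ ^ s ≤ (1 - ρ)⁻¹ := by
          rw [← tsum_geometric_of_lt_one hρ0 hρ1]
          exact (summable_geometric_of_lt_one hρ0 hρ1).sum_le_tsum _ fun n _ => by positivity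
        calc ∑ s ∈ range S, ρ ^ (s + 1) = ρ * ∑ s ∈ range S, ρ ^ s := by
              rw [mul_sum]; exact sum_congr rfl fun s _ => by ring
          _ ≤ ρ * (1 - ρ)⁻¹ := mul_le_mul_of_nonneg_left hgeom hρ0

/-- **`Z(x) < ∞` for `x < x_c`**: under Lemma 2, `Σ cₙ xⁿ` converges for `0 < x < x_c`
(Hammersley–Welsh: `Z(x) ≤ x⁻¹ H(x)²`, `H(x) ≤ 2 ∏_T (1 + B_T^x)`).
[cite: DuminilCopinSmirnov2012, §3 ("Therefore, Z(x) < +∞ whenever x < x_c")] -/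
theorem summable_of_lemma2 {x : ℝ} (hx : 0 < x) (hxc : x < hexCriticalFugacity) :
    Summable fun n => (hexSawCount n : ℝ) * x ^ n := by
  set K := Real.exp (2 * x⁻¹ ^ 3 * ((x / hexCriticalFugacity) * (1 - x / hexCriticalFugacity)⁻¹))
  have hH : ∀ M : ℕ, wt x (hsStd M) ≤ 2 * K := by
    intro M
    rw [hsStd, wt_hsBoth]
    refine (hSum_le_prod M M hx.le).trans ?_
    exact mul_le_mul_of_nonneg_left (prod_bSum_le hlem M M hx hxc) (by norm_num)
  refine summable_of_sum_range_le (c := x⁻¹ * (2 * K) ^ 2) (fun n => by positivity) fun N => ?_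
  cases N with
  | zero => simp; positivity
  | succ N =>
    refine (sum_hexSawCount_le N hx).trans ?_
    refine mul_le_mul_of_nonneg_left ?_ (inv_nonneg.2 hx.le)
    exact pow_le_pow_left₀ (wt_nonneg hx.le _) (hH (N + 1)) 2

/-- Under Lemma 2: `μ x < 1` for `0 < x < x_c` (`μⁿ xⁿ ≤ cₙ xⁿ` is then summable).
[cite: DuminilCopinSmirnov2012, §3 ("μ ≤ x_c⁻¹")] -/
theorem hexConnectiveConstant_mul_lt_one {x : ℝ} (hx : 0 < x) (hxc : x < hexCriticalFugacity) :
    hexConnectiveConstant * x < 1 := by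
  have hs := summable_of_lemma2 hlem hx hxc
  have hμ := hexConnectiveConstant_pos
  have hgeom : Summable fun n : ℕ => (hexConnectiveConstant * x) ^ n := by
    refine Summable.of_nonneg_of_le (fun n => by positivity) (fun n => ?_) hs
    rw [mul_pow]
    exact mul_le_mul_of_nonneg_right (hexConnectiveConstant_pow_le n) (by positivity)
  have := summable_geometric_iff_norm_lt_one.1 hgeom
  rwa [Real.norm_of_nonneg (by positivity)] at this

/-- **Upper bound of Theorem 1 from Lemma 2**: `μ(ℍ) ≤ √(2+√2)`.
[cite: DuminilCopinSmirnov2012, §3 (proof of Theorem 1, "μ ≤ x_c⁻¹ = √(2+√2)")] -/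
theorem hexConnectiveConstant_le_sqrt_of_lemma2 :
    hexConnectiveConstant ≤ Real.sqrt (2 + Real.sqrt 2) := by
  rw [← inv_inv (Real.sqrt (2 + Real.sqrt 2)), ← hexCriticalFugacity]
  by_contra hlt
  push Not at hlt
  have hμ := hexConnectiveConstant_pos
  have hxc := hexCriticalFugacity_pos_lt_one.1
  -- pick `x` with `μ⁻¹ < x < x_c`
  have : hexConnectiveConstant⁻¹ < hexCriticalFugacity := inv_lt_of_inv_lt₀ hxc hlt
  obtain ⟨x, hx1, hx2⟩ := exists_between this
  have hx0 : 0 < x := (inv_pos.2 hμ).trans hx1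
  have h1 := hexConnectiveConstant_mul_lt_one hlem hx0 hx2
  have h2 : 1 < hexConnectiveConstant * x := by
    have := mul_lt_mul_of_pos_left hx1 hμ
    rwa [mul_inv_cancel₀ hμ.ne'] at this
  linarith

/-- **Theorem 1 of Duminil-Copin–Smirnov from their Lemma 2**: the strip identity
`1 = c_α A_{T,L} + B_{T,L} + c_ε E_{T,L}` (for all `T ≥ 1`, `L`) implies
`cₙ(ℍ)^{1/n} → √(2+√2)`. [cite: DuminilCopinSmirnov2012, Thm 1 and §3] -/
theorem DuminilCopinSmirnov2012_thm1_of_lemma2 : DuminilCopinSmirnov2012_thm1 := by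
  have h : hexConnectiveConstant = Real.sqrt (2 + Real.sqrt 2) :=
    le_antisymm (hexConnectiveConstant_le_sqrt_of_lemma2 hlem)
      (sqrt_le_hexConnectiveConstant_of_lemma2 hlem)
  rw [DuminilCopinSmirnov2012_thm1, ← h]
  exact tendsto_hexSawCount_rpow

end UpperBound

end Literature.Probability.RandomPlanarGeometry.SAW
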